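import Summits.Schanuel.Schanuel.Theorems.RootDecomp1KHyper43

/-!
# RootDecomp1KHyper — lens 6, generation 15 ADDENDUM 4 «UNIFORM n-PARAMETRIC ANCHORED THEOREM» (MeasuredAnchors.lean d7ef80c6…, 1059 l) — continuation (RootDecomp1KHyper44): §C (sections `Anchors`, `AnchorsTwo`): `sgMat`, `amax`, SIEGEL `exists_siegel_relation`, `relation_eval`, `aeval_S` / `totalDegree_S_le` / `mvlen_S_le`, `weakLatLBk_of_mvWeakMeasure`, `level_helper`, `mul_exp_neg_le_one` (private)

(lens-6 g15 ADDENDUM 4 `MeasuredAnchors.lean`, sha256 d7ef80c6…6d97, own farm rc 0 · 0 sorry · axioms std; critic VERDICT STATUS L1634 (K-R18 MET; PORT GO (e)),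
CENSUS-REQUEST L1629; port by census-1 gen 15 in five parts RootDecomp1KHyper42–46; statements and proofs verbatim, one-line docstrings added,
generic one-liners / twins of landed lemmas made `private` with per-part private copies; `--supports stmt-Schanuel-33363`, no census credit.
Nothing here proves Schanuel; rung 0.)
-/

open Complex IntermediateField Polynomial

namespace Summit.Schanuel.Schanuel.Theorems.RootDecomp1KHyper

namespace HyperCell

/-! ## §C  Anchors and one free coordinate: integer relations (Siegel), the k-ary weak lattice bound,
the k-ary weak Lemma L, hyper-polynomial approximation -/

section Anchors

variable {k : ℕ}

/-- The Siegel matrix of the anchor coefficient vectors `a l`, a form `h` and the unit vector `e_j`. -/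
def sgMat (a : Fin k → Fin (k + 1) → ℤ) (h : Fin (k + 1) → ℤ) (j : Fin (k + 1)) :
    Matrix (Fin (k + 1)) (Fin k ⊕ Bool) ℤ :=
  fun i c => match c with
    | Sum.inl l => a l i
    | Sum.inr false => h i
    | Sum.inr true => if i = j then 1 else 0

/-- `Σ_l Σ_i |a l i|`. -/
def amax (a : Fin k → Fin (k + 1) → ℤ) : ℝ := ∑ l, ∑ i, |(a l i : ℝ)|

/-- `amax a ≥ 0`. -/
theorem amax_nonneg (a : Fin k → Fin (k + 1) → ℤ) : 0 ≤ amax a :=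
  Finset.sum_nonneg fun _ _ => Finset.sum_nonneg fun _ _ => abs_nonneg _

/-- Every entry `|a l i|` is bounded by `amax a`. -/
theorem abs_le_amax (a : Fin k → Fin (k + 1) → ℤ) (l : Fin k) (i : Fin (k + 1)) :
    |(a l i : ℝ)| ≤ amax a := by
  unfold amax
  calc |(a l i : ℝ)| ≤ ∑ i', |(a l i' : ℝ)| :=
        Finset.single_le_sum (f := fun i' => |(a l i' : ℝ)|) (fun _ _ => abs_nonneg _)
          (Finset.mem_univ i)
    _ ≤ ∑ l', ∑ i', |(a l' i' : ℝ)| :=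
        Finset.single_le_sum (f := fun l' => ∑ i', |(a l' i' : ℝ)|)
          (fun _ _ => Finset.sum_nonneg fun _ _ => abs_nonneg _) (Finset.mem_univ l)

/-- **Integer relation with bounded coefficients (Siegel's lemma).**  For anchor vectors `a l`, a form
`h` and a coordinate `j` there are integers `t l, th, te`, not all zero, bounded by
`((k+2)(1 + amax a + |h|₁))^{k+1}`, with `Σ_l t_l a_l + th h + te e_j = 0`. -/
theorem exists_siegel_relation (a : Fin k → Fin (k + 1) → ℤ) (h : Fin (k + 1) → ℤ)
    (j : Fin (k + 1)) :
    ∃ (t : Fin k → ℤ) (th te : ℤ), (t ≠ 0 ∨ th ≠ 0 ∨ te ≠ 0) ∧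
      (∀ i, (∑ l, a l i * t l) + h i * th + (if i = j then te else 0) = 0) ∧
      (∀ l, |(t l : ℝ)| ≤ (((k + 2 : ℕ) : ℝ) * (1 + amax a + ∑ i, |(h i : ℝ)|)) ^ (k + 1)) ∧
      |(th : ℝ)| ≤ (((k + 2 : ℕ) : ℝ) * (1 + amax a + ∑ i, |(h i : ℝ)|)) ^ (k + 1) ∧
      |(te : ℝ)| ≤ (((k + 2 : ℕ) : ℝ) * (1 + amax a + ∑ i, |(h i : ℝ)|)) ^ (k + 1) := by
  classical
  set A := sgMat a h j with hAdef
  have hn : Fintype.card (Fin (k + 1)) < Fintype.card (Fin k ⊕ Bool) := by simp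
  have hm : 0 < Fintype.card (Fin (k + 1)) := by simp
  obtain ⟨t', ht'0, hAt, hnorm⟩ := Int.Matrix.exists_ne_zero_int_vec_norm_le A hn hm
  set R : ℝ := 1 + amax a + ∑ i, |(h i : ℝ)| with hRdef
  have hh0 : 0 ≤ ∑ i, |(h i : ℝ)| := Finset.sum_nonneg fun _ _ => abs_nonneg _
  have hR1 : 1 ≤ R := by rw [hRdef]; linarith [amax_nonneg a]
  have hR0 : 0 ≤ R := by linarith
  -- the entrywise bound ‖A‖ ≤ R
  have hAent : ∀ i c, ‖A i c‖ ≤ R := by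
    intro i c
    rw [Int.norm_eq_abs]
    rcases c with l | b
    · show |((a l i : ℤ) : ℝ)| ≤ R
      rw [hRdef]; linarith [abs_le_amax a l i, hh0]
    · cases b
      · show |((h i : ℤ) : ℝ)| ≤ R
        have : |(h i : ℝ)| ≤ ∑ i', |(h i' : ℝ)| :=
          Finset.single_le_sum (f := fun i' => |(h i' : ℝ)|) (fun _ _ => abs_nonneg _)
            (Finset.mem_univ i)
        rw [hRdef]; linarith [amax_nonneg a]
      · show |(((if i = j then 1 else 0 : ℤ)) : ℝ)| ≤ R
        split_ifs <;> simp <;> linarith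
  have hAnorm := (Matrix.norm_le_iff hR0 (A := A)).mpr hAent
  have hmax := max_le hR1 hAnorm
  -- the exponent is k + 1
  have hcardβ : (Fintype.card (Fin k ⊕ Bool) : ℝ) = ((k + 2 : ℕ) : ℝ) := by
    norm_num [Fintype.card_sum, Fintype.card_fin, Fintype.card_bool]
  have hcardα : (Fintype.card (Fin (k + 1)) : ℝ) = ((k + 1 : ℕ) : ℝ) := by
    norm_num [Fintype.card_fin]
  have hexp : ((Fintype.card (Fin (k + 1)) : ℝ) /
      ((Fintype.card (Fin k ⊕ Bool) : ℝ) - (Fintype.card (Fin (k + 1)) : ℝ))) =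
        ((k + 1 : ℕ) : ℝ) := by
    rw [hcardβ, hcardα]; push_cast; ring
  rw [hexp, Real.rpow_natCast, hcardβ] at hnorm
  have hB : ‖t'‖ ≤ (((k + 2 : ℕ) : ℝ) * R) ^ (k + 1) := by
    refine hnorm.trans (pow_le_pow_left₀ (by positivity) ?_ _)
    exact mul_le_mul_of_nonneg_left hmax (by positivity)
  have hent : ∀ c, |(t' c : ℝ)| ≤ (((k + 2 : ℕ) : ℝ) * R) ^ (k + 1) := by
    intro c
    have h1 : ‖t' c‖ ≤ ‖t'‖ := norm_le_pi_norm t' c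
    rw [Int.norm_eq_abs] at h1
    exact h1.trans hB
  refine ⟨fun l => t' (Sum.inl l), t' (Sum.inr false), t' (Sum.inr true), ?_, ?_,
    fun l => hent _, hent _, hent _⟩
  · by_contra hcon
    push Not at hcon
    obtain ⟨h1, h2, h3⟩ := hcon
    apply ht'0
    funext c
    rcases c with l | b
    · exact congr_fun h1 l
    · cases b
      · exact h2
      · exact h3
  · intro i
    have hi := congr_fun hAt i
    simp only [Matrix.mulVec, dotProduct, Fintype.sum_sum_type, Fintype.sum_bool,
      Pi.zero_apply] at hi
    have e1 : ∀ l, A i (Sum.inl l) = a l i := fun l => rfl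
    have e2 : A i (Sum.inr false) = h i := rfl
    have e3 : A i (Sum.inr true) = if i = j then 1 else 0 := rfl
    simp only [e1, e2, e3] at hi
    have e4 : (if i = j then (1 : ℤ) else 0) * t' (Sum.inr true) =
        if i = j then t' (Sum.inr true) else 0 := by split_ifs <;> simp
    rw [e4] at hi
    linarith [hi]

end Anchors

section AnchorsTwo

variable {k : ℕ}

/-- Evaluating an integer relation `Σ_l t_l a_l + th h + te e_j = 0` at `z`:
`Σ_l t_l v_l + th ε + te z_j = 0` (`v_l = a_l · z`, `ε = h · z`). -/
theorem relation_eval {z : Fin (k + 1) → ℂ} (a : Fin k → Fin (k + 1) → ℤ) (h : Fin (k + 1) → ℤ)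
    (j : Fin (k + 1)) {t : Fin k → ℤ} {th te : ℤ}
    (hrel : ∀ i, (∑ l, a l i * t l) + h i * th + (if i = j then te else 0) = 0) :
    ∑ l, (t l : ℂ) * (∑ i, (a l i : ℂ) * z i) + (th : ℂ) * (∑ i, (h i : ℂ) * z i) +
      (te : ℂ) * z j = 0 := by
  classical
  have key : ∑ l, (t l : ℂ) * (∑ i, (a l i : ℂ) * z i) + (th : ℂ) * (∑ i, (h i : ℂ) * z i) +
      (te : ℂ) * z j =
        ∑ i, ((((∑ l, a l i * t l) + h i * th + (if i = j then te else 0) : ℤ)) : ℂ) * z i := by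
    have e1 : ∑ l, (t l : ℂ) * (∑ i, (a l i : ℂ) * z i) = ∑ i, (∑ l, (a l i : ℂ) * t l) * z i := by
      simp only [Finset.mul_sum, Finset.sum_mul]
      rw [Finset.sum_comm]
      exact Finset.sum_congr rfl fun i _ => Finset.sum_congr rfl fun l _ => by ring
    have e2 : (th : ℂ) * (∑ i, (h i : ℂ) * z i) = ∑ i, ((h i : ℂ) * th) * z i := by
      rw [Finset.mul_sum]; exact Finset.sum_congr rfl fun i _ => by ring
    have e3 : (te : ℂ) * z j = ∑ i, (((if i = j then te else 0 : ℤ)) : ℂ) * z i := by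
      rw [Finset.sum_eq_single j]
      · simp
      · intro i _ hij; simp [hij]
      · intro hj; exact absurd (Finset.mem_univ j) hj
    rw [e1, e2, e3, ← Finset.sum_add_distrib, ← Finset.sum_add_distrib]
    refine Finset.sum_congr rfl fun i _ => ?_
    push_cast
    ring
  rw [key]
  exact Finset.sum_eq_zero fun i _ => by rw [hrel i]; simp

variable {N : ℕ}

/-- Evaluating the integer combination `Σ_l t_l · W_l` at `θ`: `Σ_l t_l · W_l(θ)`. -/
theorem aeval_S (θ : Fin N → ℂ) (W : Fin k → MvPolynomial (Fin N) ℤ) (t : Fin k → ℤ) :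
    MvPolynomial.aeval θ (∑ l, MvPolynomial.C (t l) * W l) =
      ∑ l, (t l : ℂ) * MvPolynomial.aeval θ (W l) := by
  rw [map_sum]
  refine Finset.sum_congr rfl fun l _ => ?_
  simp only [map_mul, MvPolynomial.aeval_C, algebraMap_int_eq, Int.coe_castRingHom]

/-- The combination `Σ_l t_l · W_l` has total degree `≤ d` when every `W_l` has. -/
theorem totalDegree_S_le (W : Fin k → MvPolynomial (Fin N) ℤ) {d : ℕ}
    (hWd : ∀ l, (W l).totalDegree ≤ d) (t : Fin k → ℤ) :
    (∑ l, MvPolynomial.C (t l) * W l).totalDegree ≤ d :=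
  MvPolynomial.totalDegree_finsetSum_le fun l _ =>
    (MvPolynomial.totalDegree_mul _ _).trans (by rw [MvPolynomial.totalDegree_C, zero_add]; exact hWd l)

/-- Length of the combination: `mvlen (Σ_l t_l · W_l) ≤ Σ_l |t_l| · mvlen W_l`. -/
theorem mvlen_S_le (W : Fin k → MvPolynomial (Fin N) ℤ) (t : Fin k → ℤ) :
    mvlen (∑ l, MvPolynomial.C (t l) * W l) ≤ ∑ l, |t l| * mvlen (W l) :=
  (mvlen_sum_le _ _).trans (Finset.sum_le_sum fun _ _ => mvlen_C_mul_le _ _)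

/-- **k-ary weak lattice bound from a simultaneous weak measure.** -/
theorem weakLatLBk_of_mvWeakMeasure {θ : Fin N → ℂ} (hθ : MvWeakMeasure θ)
    (W : Fin k → MvPolynomial (Fin N) ℤ)
    (hW : ∀ U : Fin k → ℤ, U ≠ 0 → ∑ l, MvPolynomial.C (U l) * W l ≠ 0) :
    ∃ (Cw : ℝ) (kw : ℕ), 0 < Cw ∧ ∀ U : Fin k → ℤ, U ≠ 0 →
      Real.exp (-(Cw * (1 + ∑ l, |(U l : ℝ)|) ^ kw)) ≤
        ‖∑ l, (U l : ℂ) * MvPolynomial.aeval θ (W l)‖ := by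
  set d : ℕ := Finset.univ.sup fun l => (W l).totalDegree with hd
  have hWd : ∀ l, (W l).totalDegree ≤ d := fun l =>
    Finset.le_sup (f := fun l => (W l).totalDegree) (Finset.mem_univ l)
  obtain ⟨Cm, kk, hCm, hmeas⟩ := hθ d
  have hl0 : ∀ l, (0 : ℝ) ≤ ((mvlen (W l) : ℤ) : ℝ) := fun l => by exact_mod_cast mvlen_nonneg _
  set Λ : ℝ := 1 + ∑ l, ((mvlen (W l) : ℤ) : ℝ) with hΛ
  have hΛ0 : 0 ≤ ∑ l, ((mvlen (W l) : ℤ) : ℝ) := Finset.sum_nonneg fun l _ => hl0 l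
  have hΛ1 : 1 ≤ Λ := by rw [hΛ]; linarith
  refine ⟨Cm * Λ ^ kk, kk, by positivity, fun U hU => ?_⟩
  have hU0 : 0 ≤ ∑ l, |(U l : ℝ)| := Finset.sum_nonneg fun _ _ => abs_nonneg _
  have hlow := hmeas _ (hW U hU) (totalDegree_S_le W hWd U)
  rw [aeval_S] at hlow
  refine le_trans (Real.exp_le_exp.mpr (neg_le_neg ?_)) hlow
  have hlen : ((mvlen (∑ l, MvPolynomial.C (U l) * W l) : ℤ) : ℝ) ≤
      Λ * (1 + ∑ l, |(U l : ℝ)|) := by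
    have h1 : ((mvlen (∑ l, MvPolynomial.C (U l) * W l) : ℤ) : ℝ) ≤
        ((∑ l, |U l| * mvlen (W l) : ℤ) : ℝ) := by exact_mod_cast mvlen_S_le W U
    refine h1.trans ?_
    push_cast
    have h2 : ∀ l, |(U l : ℝ)| * ((mvlen (W l) : ℤ) : ℝ) ≤
        ((mvlen (W l) : ℤ) : ℝ) * (1 + ∑ l', |(U l' : ℝ)|) := by
      intro l
      have hUl : |(U l : ℝ)| ≤ 1 + ∑ l', |(U l' : ℝ)| := by
        have := Finset.single_le_sum (f := fun l' => |(U l' : ℝ)|) (fun _ _ => abs_nonneg _)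
          (Finset.mem_univ l)
        linarith
      nlinarith [hl0 l, abs_nonneg (U l : ℝ)]
    calc ∑ l, |(U l : ℝ)| * ((mvlen (W l) : ℤ) : ℝ)
        ≤ ∑ l, ((mvlen (W l) : ℤ) : ℝ) * (1 + ∑ l', |(U l' : ℝ)|) :=
          Finset.sum_le_sum fun l _ => h2 l
      _ = (∑ l, ((mvlen (W l) : ℤ) : ℝ)) * (1 + ∑ l', |(U l' : ℝ)|) := by rw [Finset.sum_mul]
      _ ≤ Λ * (1 + ∑ l', |(U l' : ℝ)|) := by
          apply mul_le_mul_of_nonneg_right _ (by linarith); rw [hΛ]; linarith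
  have hlen0 : (0 : ℝ) ≤ ((mvlen (∑ l, MvPolynomial.C (U l) * W l) : ℤ) : ℝ) := by
    exact_mod_cast mvlen_nonneg _
  calc Cm * ((mvlen (∑ l, MvPolynomial.C (U l) * W l) : ℤ) : ℝ) ^ kk
      ≤ Cm * (Λ * (1 + ∑ l, |(U l : ℝ)|)) ^ kk :=
        mul_le_mul_of_nonneg_left (pow_le_pow_left₀ hlen0 hlen kk) hCm.le
    _ = Cm * Λ ^ kk * (1 + ∑ l, |(U l : ℝ)|) ^ kk := by rw [mul_pow]; ring

/-- Level arithmetic: `c₁ X^{e₁} + c₂ X^{e₂} ≤ X^{e₁ + e₂ + extra + T}` once `2^T ≥ c₁ + c₂`, `X ≥ 2`. -/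
theorem level_helper {X c₁ c₂ : ℝ} (hX : 2 ≤ X) (hc₁ : 0 ≤ c₁) (hc₂ : 0 ≤ c₂) (e₁ e₂ extra T : ℕ)
    (hT : c₁ + c₂ ≤ (2 : ℝ) ^ T) : c₁ * X ^ e₁ + c₂ * X ^ e₂ ≤ X ^ (e₁ + e₂ + extra + T) := by
  have hX1 : 1 ≤ X := by linarith
  have h1 : 1 ≤ X ^ e₁ := one_le_pow₀ hX1
  have h2 : 1 ≤ X ^ e₂ := one_le_pow₀ hX1
  have h3 : 1 ≤ X ^ extra := one_le_pow₀ hX1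
  have hT' : c₁ + c₂ ≤ X ^ T := hT.trans (pow_le_pow_left₀ (by norm_num) hX T)
  rw [pow_add, pow_add, pow_add]
  have h4 : c₁ * X ^ e₁ ≤ c₁ * (X ^ e₁ * X ^ e₂ * X ^ extra) := by
    apply mul_le_mul_of_nonneg_left _ hc₁
    calc X ^ e₁ = X ^ e₁ * 1 * 1 := by ring
      _ ≤ X ^ e₁ * X ^ e₂ * X ^ extra := by gcongr
  have h5 : c₂ * X ^ e₂ ≤ c₂ * (X ^ e₁ * X ^ e₂ * X ^ extra) := by
    apply mul_le_mul_of_nonneg_left _ hc₂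
    calc X ^ e₂ = 1 * X ^ e₂ * 1 := by ring
      _ ≤ X ^ e₁ * X ^ e₂ * X ^ extra := by gcongr
  calc c₁ * X ^ e₁ + c₂ * X ^ e₂
      ≤ (c₁ + c₂) * (X ^ e₁ * X ^ e₂ * X ^ extra) := by linarith
    _ ≤ X ^ T * (X ^ e₁ * X ^ e₂ * X ^ extra) :=
        mul_le_mul_of_nonneg_right hT' (by positivity)
    _ = X ^ e₁ * X ^ e₂ * X ^ extra * X ^ T := by ring

/-- `u · exp(−u) ≤ 1` for `u ≥ 0`. -/
private theorem mul_exp_neg_le_one {u : ℝ} (_hu : 0 ≤ u) : u * Real.exp (-u) ≤ 1 := by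
  have h := Real.add_one_le_exp u
  rw [Real.exp_neg, mul_inv_le_iff₀ (Real.exp_pos _)]
  linarith

end AnchorsTwo

end HyperCell

end Summit.Schanuel.Schanuel.Theorems.RootDecomp1KHyper
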